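import Literature.Topology.FourManifolds.GompfFramedTwistOfTubeModel
import Literature.Topology.FourManifolds.GompfKinkModel
import HarnessLib

/-!
# Conjugating mapping tori of straightened monodromies, and the shear model as a tube-shear model

Infrastructure for the framed form of R. Gompf, *More Cappell–Shaneson spheres are standard*, Algebr.
Geom. Topol. 10 (2010), Theorem 2.1 (the named fact
`Literature.Topology.FourManifolds.gompf2010_framedTwist`). `GompfFramedTwistOfTubeModel.lean`
reduces F to fishtail twisting data for one monodromy which is the tube shear `tubeShear` on a tube
about `α`. The shear model `𝔏 = modelMonodromy` of `GompfShearModel.lean` — in which the fishtail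
neighbourhood is being made explicit (`FishtailEndModel.lean`, `FishtailSection.lean`, …) — is not of
that form, but its conjugate by the torus automorphism `C : (z₁, z₂, z₃) ↦ (z₁ z₃⁻¹, z₂, z₃)` is:
`C 𝔏 C⁻¹ = tubeShear` wherever `|arg z₂| ≤ 1` (`conjModelMonodromy_eq_tubeShear`). This file supplies
the mapping-torus half of the corresponding adapter:

* `Literature.Topology.FourManifolds.isOpenGluingWith_mTorus_conj`,
  `Literature.Topology.FourManifolds.mtConj h ψ : MTorus ψ ≃ₘ MTorus (h ∘ ψ ∘ h⁻¹)` — for any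
  diffeomorphism `h` of `T³`, `[x, s] ↦ [h x, s]` (uniqueness of open gluings with witnesses, as
  `csConj` of `GompfConjInvariance.lean` for the linear case), with `mtConj_inl`, `mtConj_inr`;
* `Literature.Topology.FourManifolds.shearC` — the matrix `C = !![1, 0, -1; 0, 1, 0; 0, 0, 1] ∈ SL(3, ℤ)`
  and the computation `Literature.Topology.FourManifolds.conjModelMonodromy_eq_tubeShear`:
  `C (𝔏 (C⁻¹ z)) = tubeShear z` for `|arg z₂| ≤ 1`;
* `Literature.Topology.FourManifolds.conjModelMonodromy` — the conjugate monodromy as a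
  diffeomorphism, the identity near `1`, equal to `tubeShear` on `axisTube 1`.

Everything here is proved; no named facts are introduced.

## References

* R. E. Gompf, *More Cappell–Shaneson spheres are standard*, Algebr. Geom. Topol. 10 (2010)
  1665–1681: §3 ¶1 (conjugation), Thm 2.1 (proof). [GompfAGT2010]
-/

open scoped Manifold ContDiff Topology Real
open Set Function Metric Complex

noncomputable section

namespace Literature.Topology.FourManifolds

/-- Local notation: `𝔼 n` is the model Euclidean space `EuclideanSpace ℝ (Fin n)`. -/
local notation "𝔼 " n:arg => EuclideanSpace ℝ (Fin n)

/-- Local notation: the model with corners `𝓣 = (𝓡 1).prod ((𝓡 1).prod (𝓡 1))` of `ThreeTorus`. -/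
local notation "𝓣" =>
  (ModelWithCorners.prod (𝓡 1) (ModelWithCorners.prod (𝓡 1) (𝓡 1)))

/-! ### Conjugating the glued mapping torus by a diffeomorphism of the fibre -/

section Conj

variable (h ψ : ThreeTorus ≃ₘ⟮𝓣, 𝓣⟯ ThreeTorus)

/-- **The conjugate monodromy `h ∘ ψ ∘ h⁻¹`.** [folklore] -/
abbrev conjMono : ThreeTorus ≃ₘ⟮𝓣, 𝓣⟯ ThreeTorus := (h.symm.trans ψ).trans h

/-- The conjugate monodromy, pointwise. [folklore] -/
theorem conjMono_apply (x : ThreeTorus) : conjMono h ψ x = h (ψ (h.symm x)) := rfl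

/-- `h (ψ x) = (h ψ h⁻¹) (h x)`. [folklore] -/
theorem conjMono_apply_apply (x : ThreeTorus) : h (ψ x) = conjMono h ψ (h x) := by
  rw [conjMono_apply, h.symm_apply_apply]

/-- **`X_{h ψ h⁻¹}` is an open gluing of the two cylinders along the relation of `ψ`**, with
witnesses `inl ∘ (h × id)`, `inr ∘ (h × id)`. [cite: GompfAGT2010, §3 ¶1 (the construction only depends on the conjugacy class)] -/
theorem isOpenGluingWith_mTorus_conj :
    IsOpenGluingWith (ModelWithCorners.prod 𝓣 𝓘(ℝ, ℝ)) (ModelWithCorners.prod 𝓣 𝓘(ℝ, ℝ)) (𝓡 4)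
      (mappingTorusRel ⇑ψ)
      ((mtGlueData (conjMono h ψ)).inl ∘ Prod.map ⇑h id)
      ((mtGlueData (conjMono h ψ)).inr ∘ Prod.map ⇑h id) := by
  obtain ⟨hA, hAo, hB, hBo, hU, hR⟩ := isOpenGluingWith_mappingTorusGlued (conjMono h ψ) linTorusModel
  have h1 : Function.Surjective (Prod.map ⇑h (id : ↥mappingTorusPieceOne → ↥mappingTorusPieceOne)) :=
    (EquivLike.surjective _).prodMap Function.surjective_id
  have h2 : Function.Surjective (Prod.map ⇑h (id : ↥mappingTorusPieceTwo → ↥mappingTorusPieceTwo)) :=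
    (EquivLike.surjective _).prodMap Function.surjective_id
  refine ⟨?_, ?_, ?_, ?_, ?_, fun a b ↦ ?_⟩
  · have := hA.comp_diffeomorph (h.prodCongr (Diffeomorph.refl 𝓘(ℝ, ℝ) ↥mappingTorusPieceOne ∞))
    simpa only [Diffeomorph.coe_prodCongr, Diffeomorph.coe_refl] using this
  · rwa [h1.range_comp]
  · have := hB.comp_diffeomorph (h.prodCongr (Diffeomorph.refl 𝓘(ℝ, ℝ) ↥mappingTorusPieceTwo ∞))
    simpa only [Diffeomorph.coe_prodCongr, Diffeomorph.coe_refl] using this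
  · rwa [h2.range_comp]
  · rwa [h1.range_comp, h2.range_comp]
  · rw [Function.comp_apply, Function.comp_apply, hR]
    exact mappingTorusRel_prodMap_iff' (EquivLike.injective _) (conjMono_apply_apply h ψ) a b

/-- **The conjugating diffeomorphism exists**: `Ĥ : X_ψ ≅ X_{h ψ h⁻¹}` with `Ĥ [x, s] = [h x, s]` on
both cylinders. [cite: GompfAGT2010, §3 ¶1 (the construction only depends on the conjugacy class)] -/
theorem exists_mtConj : ∃ Ψ : MTorus ψ ≃ₘ⟮𝓡 4, 𝓡 4⟯ MTorus (conjMono h ψ),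
    (∀ a, Ψ ((mtGlueData ψ).inl a) = (mtGlueData (conjMono h ψ)).inl (h a.1, a.2)) ∧
    (∀ b, Ψ ((mtGlueData ψ).inr b) = (mtGlueData (conjMono h ψ)).inr (h b.1, b.2)) :=
  (isOpenGluingWith_mappingTorusGlued ψ linTorusModel).exists_diffeomorph_apply_eq
    (isOpenGluingWith_mTorus_conj h ψ)

/-- **The conjugating diffeomorphism `Ĥ : X_ψ ≅ X_{h ψ h⁻¹}`, `[x, s] ↦ [h x, s]`.** [cite: GompfAGT2010, §3 ¶1 (the construction only depends on the conjugacy class)] -/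
def mtConj : MTorus ψ ≃ₘ⟮𝓡 4, 𝓡 4⟯ MTorus (conjMono h ψ) := (exists_mtConj h ψ).choose

/-- `Ĥ` on the first cylinder. [folklore] -/
theorem mtConj_inl (a : ThreeTorus × ↥mappingTorusPieceOne) :
    mtConj h ψ ((mtGlueData ψ).inl a) = (mtGlueData (conjMono h ψ)).inl (h a.1, a.2) :=
  (exists_mtConj h ψ).choose_spec.1 a

/-- `Ĥ` on the second cylinder. [folklore] -/
theorem mtConj_inr (b : ThreeTorus × ↥mappingTorusPieceTwo) :
    mtConj h ψ ((mtGlueData ψ).inr b) = (mtGlueData (conjMono h ψ)).inr (h b.1, b.2) :=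
  (exists_mtConj h ψ).choose_spec.2 b

end Conj

/-! ### The shear model conjugated: `C 𝔏 C⁻¹ = tubeShear` near the torus `{z₂ = 1}` -/

section Shear

/-- **The torus automorphism `C : (z₁, z₂, z₃) ↦ (z₁ z₃⁻¹, z₂, z₃)`** (`y₁ ↦ y₁ - y₃`). [folklore] -/
def shearC : Matrix.SpecialLinearGroup (Fin 3) ℤ := ⟨!![1, 0, -1; 0, 1, 0; 0, 0, 1], by decide⟩

/-- The entries of `C`. [folklore] -/
@[simp] theorem coe_shearC : ((shearC : Matrix.SpecialLinearGroup (Fin 3) ℤ) : Matrix (Fin 3) (Fin 3) ℤ) =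
    !![1, 0, -1; 0, 1, 0; 0, 0, 1] := rfl

/-- The inverse of `C`. [folklore] -/
theorem coe_shearC_inv : ((shearC⁻¹ : Matrix.SpecialLinearGroup (Fin 3) ℤ) : Matrix (Fin 3) (Fin 3) ℤ) =
    !![1, 0, 1; 0, 1, 0; 0, 0, 1] := by
  rw [Matrix.SpecialLinearGroup.coe_inv]
  decide

/-- `C` on `T³`: `(z₁, z₂, z₃) ↦ (z₁ z₃⁻¹, z₂, z₃)`. [folklore] -/
theorem torusDiffeomorph_shearC_apply (z : ThreeTorus) :
    torusDiffeomorph shearC z = (z.1 * z.2.2⁻¹, z.2.1, z.2.2) := by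
  rw [coe_torusDiffeomorph]
  refine torusCoord_injective (funext fun i ↦ ?_)
  rw [torusCoord_torusMap]
  fin_cases i <;> simp [torusMonomial, torusCoord, shearC, Fin.prod_univ_three]

/-- `C⁻¹` on `T³`: `(z₁, z₂, z₃) ↦ (z₁ z₃, z₂, z₃)`. [folklore] -/
theorem torusDiffeomorph_shearC_symm_apply (z : ThreeTorus) :
    (torusDiffeomorph shearC).symm z = (z.1 * z.2.2, z.2.1, z.2.2) := by
  show torusMap ((shearC⁻¹ : Matrix.SpecialLinearGroup (Fin 3) ℤ) : Matrix (Fin 3) (Fin 3) ℤ) z = _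
  refine torusCoord_injective (funext fun i ↦ ?_)
  rw [torusCoord_torusMap, coe_shearC_inv]
  fin_cases i <;> simp [torusMonomial, torusCoord, Fin.prod_univ_three]

/-- **The conjugate shear model** `ψ₀ = C ∘ 𝔏 ∘ C⁻¹` as a diffeomorphism of `T³`. [cite: GompfAGT2010, §3 ¶1 (the construction only depends on the conjugacy class)] -/
abbrev conjModelMonodromy : ThreeTorus ≃ₘ⟮𝓣, 𝓣⟯ ThreeTorus := conjMono (torusDiffeomorph shearC) modelMonodromy

/-- **The formula `ψ₀ (z₁, z₂, z₃) = (z₁ F⁻¹, z₂, z₃ F)`, `F = (z₁ z₃) · shearFactor 1 (z₁ z₃) z₂`**: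
a twist along `e₂ - e₀` driven by the diagonal `z₁ z₃` (cut off in `z₂`). [folklore] -/
theorem conjModelMonodromy_apply (z : ThreeTorus) :
    conjModelMonodromy z = (z.1 * (z.1 * z.2.2 * shearFactor 1 (z.1 * z.2.2) z.2.1)⁻¹, z.2.1,
      z.2.2 * (z.1 * z.2.2 * shearFactor 1 (z.1 * z.2.2) z.2.1)) := by
  rw [conjMono_apply, torusDiffeomorph_shearC_symm_apply, coe_modelMonodromy, torusDiffeomorph_shearC_apply]
  ext1
  · exact circle_eq_of_coe_eq (by push_cast; field_simp)
  · ext1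
    · rfl
    · exact circle_eq_of_coe_eq (by push_cast; ring)

/-- **`ψ₀ = tubeShear` wherever `|arg z₂| ≤ 1`** (there the bump `χ(z₂)` is `1`, so
`(z₁ z₃) shearFactor 1 (z₁ z₃) z₂ = shearF (z₁ z₃)`). [cite: GompfAGT2010, Thm 2.1 (hypotheses: φ(α) ⊂ T)] -/
theorem conjModelMonodromy_eq_tubeShear {z : ThreeTorus} (hz : |arg (z.2.1 : ℂ)| ≤ 1) :
    conjModelMonodromy z = tubeShear z := by
  have hχ : nearBump z.2.1 = 1 := by
    have h := nearBump_exp (θ := arg (z.2.1 : ℂ)) hz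
    rwa [Circle.exp_arg] at h
  have hF : z.1 * z.2.2 * shearFactor 1 (z.1 * z.2.2) z.2.1 = shearF (z.1 * z.2.2) := by
    simp only [shearF, shearFactor, hχ, one_mul, mul_one]
  rw [conjModelMonodromy_apply, hF, tubeShear]

/-- `ψ₀` is the identity on the cube `|vᵢ| < 1/2` (both `C` and `𝔏` are explicit there). [folklore] -/
theorem conjModelMonodromy_expT (v : 𝔼 3) (hv : ∀ i, |v i| < 1 / 2) : conjModelMonodromy (expT v) = expT v := by
  have h02 : |v 0 + v 2| < 1 := by
    have a := abs_lt.1 (hv 0); have b := abs_lt.1 (hv 2)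
    exact abs_lt.2 ⟨by linarith, by linarith⟩
  have h1 : |v 1| < 1 := (hv 1).trans (by norm_num)
  rw [conjModelMonodromy_apply]
  have hprod : (expT v).1 * (expT v).2.2 = Circle.exp (v 0 + v 2) := by
    show Circle.exp (v 0) * Circle.exp (v 2) = _
    rw [← Circle.exp_add]
  have hF : (expT v).1 * (expT v).2.2 * shearFactor 1 ((expT v).1 * (expT v).2.2) (expT v).2.1 = 1 := by
    rw [hprod]
    show Circle.exp (v 0 + v 2) * shearFactor 1 (Circle.exp (v 0 + v 2)) (Circle.exp (v 1)) = 1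
    rw [shearFactor_exp 1 h02 h1, ← Circle.exp_add, one_mul, add_neg_cancel, Circle.exp_zero]
  rw [hF, inv_one, mul_one, mul_one]

/-- `ψ₀` is the identity on the ball `‖v‖ < 1/2`. [folklore] -/
theorem conjModelMonodromy_expT_of_norm_lt (v : 𝔼 3) (hv : ‖v‖ < 1 / 2) : conjModelMonodromy (expT v) = expT v :=
  conjModelMonodromy_expT v fun i ↦
    lt_of_le_of_lt ((Real.norm_eq_abs _).symm.le.trans (PiLp.norm_apply_le v i)) hv

/-- **`ψ₀ = tubeShear` on the tube `axisTube 1`.** [cite: GompfAGT2010, Thm 2.1 (hypotheses: φ(α) ⊂ T)] -/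
theorem conjModelMonodromy_eq_tubeShear_of_lt {z : ThreeTorus} (hy : |arg (z.2.1 : ℂ)| < 1)
    (_hℓ : |arg (z.2.2 : ℂ)| < 1) : conjModelMonodromy z = tubeShear z :=
  conjModelMonodromy_eq_tubeShear hy.le

/-- **F from tube-shear twisting data for the conjugate shear model** (`gompf2010_framedTwist_of_tubeShearModel`
with `ψ₀ = C 𝔏 C⁻¹`, `r₁ = 1`). [cite: GompfAGT2010, Thm 2.1 and §4 ¶3] -/
theorem gompf2010_framedTwist_of_conjModel
    (hdata : ∀ (r : ℝ) (_ : 0 < r) (hrr : r ≤ 1),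
      ∃ (ε : ℝ) (hε : 0 < ε) (hεπ : ε ≤ π) (_ : ε ≤ r / 2) (_ : ε ≤ 1)
        (hψ₀ : ∀ v : 𝔼 3, ‖v‖ < ε → conjModelMonodromy (expT v) = expT v)
        (τ : ℝ) (hτ : 0 < τ) (hτ' : τ < π / 2) (η : ℝ) (_ : 0 < η)
        (Vδ : TopologicalSpace.Opens (ThreeTorus × ↥mappingTorusPieceTwo))
        (_ : fibreSliver (farSupport τ) ⊆ Vδ) (hV1 : ∀ b ∈ Vδ, b.1 ≠ 1)
        (_ : ∀ b ∈ Vδ, sliverTwist (farDehn hτ hτ').symm b ∈ Vδ) (_ : ∀ b ∈ Vδ, b ∈ bicollarPiece η)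
        (G : ↥((prodTube conjModelMonodromy ε hε hεπ hψ₀).localOpens
            (prodSliverCompl conjModelMonodromy (isClosed_farSupport τ))) ≃ₘ⟮𝓡 4, 𝓡 4⟯
          ↥((prodTube conjModelMonodromy ε hε hεπ hψ₀).localOpens
            (prodSliverCompl conjModelMonodromy (isClosed_farSupport τ))))
        (Ksupp : Set (prodSurgered conjModelMonodromy ε hε hεπ hψ₀)),
        (∀ (x : ↥((prodTube conjModelMonodromy ε hε hεπ hψ₀).localOpens
              (prodSliverCompl conjModelMonodromy (isClosed_farSupport τ))))
            (b : ↥Vδ), (b : ThreeTorus × ↥mappingTorusPieceTwo) ∉ fibreSliver (farSupport τ) →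
            (x : prodSurgered conjModelMonodromy ε hε hεπ hψ₀) =
              (prodTube conjModelMonodromy ε hε hεπ hψ₀).glueData.inl
                (opensToComplement (prodTube conjModelMonodromy ε hε hεπ hψ₀) (mtGlueData conjModelMonodromy).inr Vδ
                  (inr_not_mem_range_secCircle_self conjModelMonodromy hε hεπ hψ₀ Vδ hV1) b) →
            ∃ a' : ↥(prodTube conjModelMonodromy ε hε hεπ hψ₀).complement,
              (a' : MTorus conjModelMonodromy) = (mtGlueData conjModelMonodromy).inr (sliverTwist (farDehn hτ hτ') b) ∧
                (G x : prodSurgered conjModelMonodromy ε hε hεπ hψ₀) =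
                  (prodTube conjModelMonodromy ε hε hεπ hψ₀).glueData.inl a') ∧
        IsClosed Ksupp ∧
        Ksupp ⊆ (prodTube conjModelMonodromy ε hε hεπ hψ₀).localOpens
          (twistNbhd conjModelMonodromy η (axisTube (hrr.trans one_lt_pi'.le)) (Diffeotopy.refl 𝓣 ThreeTorus)
            (Diffeomorph.refl 𝓣 ThreeTorus ∞)) ∧
        ∀ x : ↥((prodTube conjModelMonodromy ε hε hεπ hψ₀).localOpens
            (prodSliverCompl conjModelMonodromy (isClosed_farSupport τ))),
          (x : prodSurgered conjModelMonodromy ε hε hεπ hψ₀) ∉ Ksupp → G x = x) :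
    gompf2010_framedTwist :=
  gompf2010_framedTwist_of_tubeShearModel conjModelMonodromy one_pos one_lt_pi'.le
    (fun _ hy hℓ ↦ conjModelMonodromy_eq_tubeShear_of_lt hy hℓ) hdata

end Shear

end Literature.Topology.FourManifolds
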